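import Mathlib
import Summits.CriticalPhenomena.CardyFormulaZ2.Theorems.CardyMagicRigidityNestingRigidityBondLoopTraversalSides
import HarnessLib

/-!
# (H1) for bond-`ℤ²` interface loops, brick 3: the data attached to one traversal

Crux `Summit.CriticalPhenomena.CardyFormulaZ2.Theses.CardyMagicRigidity.NestingRigidity`
(stmt-CriticalPhenomena-4835), line `positive-cone-weight-doubling`, stub `bond_loop_traversalBound`.
Continuation of bricks 1–2 (`…BondLoopTraversalTransfer`, `…BondLoopTraversalSides`).  For the rounded
Jordan loop `Λ` of the orbit of a periodic corner (read on `[0, 1]`) and one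
traversal of the shell `D(x; ρ, R)` between times `s ≤ t`, with `ρ ≤ q₁`, `q₁ + 40δ ≤ q₂ ≤ R`, the lemma
`BondLoopH1.exists_traversal_data` produces (Aizenman–Burchard 1999, App. A, one "crossing segment" and its
"sector"): a strict crossing `[a, b] ⊆ [s, t]` of the closed shell `q₁ ≤ |z - x| ≤ q₂`; a dart `m` whose
touch point (brick 2) lies on `Λ([a, b])`, in the open annulus `U`, and in the closure of the component `S`
of the primal vertex of `m` in `U` minus the trace; and a stretch of darts `k₀ ≤ … ≤ k₁` whose primal
vertices lie in `S`, the first within `q₁ + 11δ` of `x` and the last beyond `q₂ - 11δ` (or conversely) — an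
open chain of the configuration across `A(x; q₁ + 11δ, q₂ - 11δ)` inside the sector.  The middle dart is the
current dart at a time where `|Λ - x| = (q₁ + q₂)/2`; its slot lies strictly inside the inner strict
crossing because darts at radial distances `> 6δ` apart differ (brick 1).  Registered anchor:
`bondLoopH1_exists_sector_chain`.
-/

noncomputable section

open MeasureTheory Set Filter Metric TopologicalSpace Function
open scoped Topology ENNReal NNReal unitInterval

namespace Summit.CriticalPhenomena.CardyFormulaZ2.Cruxes.NestingRigidity.PositiveConeWeightDoubling

open Literature.Probability.RandomPlanarGeometry Literature.Probability.Percolation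
  Literature.Probability.LatticeModels

/-! Local notations (no definitions are introduced): the rounded Jordan loop of the orbit of the corner `p`
of `β` at mesh `δ`, read on `[0, 1]`, and the index `⌊Q t⌋` of the current dart at time `t`. -/
local notation3 "RC[" β ", " p ", " δ "]" =>
  (Curve.ofPeriodic (OrbitPolygon.loop β p δ) OrbitPolygon.continuous_loop : Curve ℂ)
local notation3 "uIdx[" Q ", " t "]" => ⌊(Q : ℝ) * ((t : unitInterval) : ℝ)⌋₊

namespace BondLoopH1

variable {β : BondConfig (Site 2)} {p : Site 2 × Fin 4} {δ : ℝ}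

/-- **A time at a prescribed intermediate level** strictly inside a crossing `[c, d]` of the levels
`p₁, p₂` (either direction) by `t ↦ |Λ t - x|`. [folklore] -/
theorem exists_time_at_level {Λ : Curve ℂ} {x : ℂ} {p₁ p₂ lev : ℝ} {c d : I} (hcd : c < d)
    (hends : (dist (Λ c) x = p₁ ∧ dist (Λ d) x = p₂) ∨ (dist (Λ c) x = p₂ ∧ dist (Λ d) x = p₁))
    (h1 : p₁ < lev) (h2 : lev < p₂) : ∃ u : I, c < u ∧ u < d ∧ dist (Λ u) x = lev := by
  set f : I → ℝ := fun u ↦ dist (Λ u) x with hf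
  have hfc : Continuous f := Λ.continuous.dist continuous_const
  obtain ⟨u, ⟨hcu, hud⟩, hu⟩ : lev ∈ f '' Icc c d := by
    rcases hends with ⟨hc, hd⟩ | ⟨hc, hd⟩
    · exact intermediate_value_Icc hcd.le hfc.continuousOn
        ⟨by rw [show f c = p₁ from hc]; exact h1.le, by rw [show f d = p₂ from hd]; exact h2.le⟩
    · exact intermediate_value_Icc' hcd.le hfc.continuousOn
        ⟨by rw [show f d = p₁ from hd]; exact h1.le, by rw [show f c = p₂ from hc]; exact h2.le⟩
  refine ⟨u, lt_of_le_of_ne hcu ?_, lt_of_le_of_ne hud ?_, hu⟩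
  · rintro rfl
    rcases hends with ⟨hc, -⟩ | ⟨hc, -⟩ <;> rw [show f c = _ from hc] at hu <;> linarith
  · rintro rfl
    rcases hends with ⟨-, hd⟩ | ⟨-, hd⟩ <;> rw [show f u = _ from hd] at hu <;> linarith

/-- **The data of one traversal** (see the module docstring). [cite: AizenmanBurchardDuke1999, Appendix A] -/
theorem exists_traversal_data (hp : p ∈ periodicPts (nextCorner β)) (hδ : 0 < δ) {x : ℂ}
    {ρ R q₁ q₂ : ℝ} (hρq : ρ ≤ q₁) (hgap : q₁ + 40 * δ ≤ q₂) (hqR : q₂ ≤ R) {s t : I}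
    (htr : RC[β, p, δ].IsTraversal x ρ R s t) :
    ∃ (a b : I) (dir : Bool) (m k₀ k₁ : ℕ) (z : ℂ),
      s ≤ a ∧ a < b ∧ b ≤ t ∧
      (dist (RC[β, p, δ] a) x = if dir then q₁ else q₂) ∧
      (dist (RC[β, p, δ] b) x = if dir then q₂ else q₁) ∧
      (∀ v, a < v → v < b → q₁ < dist (RC[β, p, δ] v) x ∧ dist (RC[β, p, δ] v) x < q₂) ∧
      z ∈ RC[β, p, δ] '' {v | a ≤ v ∧ v ≤ b} ∧
      (q₁ < dist z x ∧ dist z x < q₂) ∧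
      z ∈ closure (connectedComponentIn
        ({z | q₁ < dist z x ∧ dist z x < q₂} \ range (OrbitPolygon.loop β p δ))
        (meshPoint δ (OrbitPolygon.cv β p m))) ∧
      k₀ ≤ k₁ ∧
      (∀ k, k₀ ≤ k → k ≤ k₁ → meshPoint δ (OrbitPolygon.cv β p k) ∈ connectedComponentIn
        ({z | q₁ < dist z x ∧ dist z x < q₂} \ range (OrbitPolygon.loop β p δ))
        (meshPoint δ (OrbitPolygon.cv β p m))) ∧
      ((dist (meshPoint δ (OrbitPolygon.cv β p k₀)) x ≤ q₁ + 11 * δ ∧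
          q₂ - 11 * δ ≤ dist (meshPoint δ (OrbitPolygon.cv β p k₁)) x) ∨
        (q₂ - 11 * δ ≤ dist (meshPoint δ (OrbitPolygon.cv β p k₀)) x ∧
          dist (meshPoint δ (OrbitPolygon.cv β p k₁)) x ≤ q₁ + 11 * δ)) := by
  set Λ := RC[β, p, δ] with hΛ
  set Q := minimalPeriod (nextCorner β) p with hQdef
  have hQ : 0 < Q := minimalPeriod_pos_of_mem_periodicPts hp
  set U : Set ℂ := {z | q₁ < dist z x ∧ dist z x < q₂} with hU
  have hq : q₁ < q₂ := by linarith
  -- the outer strict crossing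
  obtain ⟨a, b, hsa, hab, hbt, hlev, hstrict⟩ := exists_strict_crossing_of_isTraversal htr hρq hq hqR
  -- the inner strict crossing of the levels `p₁ = q₁ + 8δ`, `p₂ = q₂ - 8δ`
  have htrav' : Λ.IsTraversal x q₁ q₂ a b := by
    refine ⟨hab.le, ?_⟩
    rcases hlev with ⟨ha, hb⟩ | ⟨ha, hb⟩
    · exact Or.inl ⟨ha.le, hb.ge⟩
    · exact Or.inr ⟨ha.ge, hb.le⟩
  obtain ⟨c, d, hac, hcd, hdb, hlev', hstrict'⟩ := exists_strict_crossing_of_isTraversal htrav'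
    (show q₁ ≤ q₁ + 8 * δ by linarith) (show q₁ + 8 * δ < q₂ - 8 * δ by linarith)
    (show q₂ - 8 * δ ≤ q₂ by linarith)
  have hmid' : ∀ v, c ≤ v → v ≤ d → q₁ + 8 * δ ≤ dist (Λ v) x ∧ dist (Λ v) x ≤ q₂ - 8 * δ := by
    intro v hcv hvd
    rcases eq_or_lt_of_le hcv with h | h
    · subst h
      rcases hlev' with ⟨h1, -⟩ | ⟨h1, -⟩ <;> rw [h1] <;> constructor <;> linarith
    rcases eq_or_lt_of_le hvd with h' | h'
    · subst h'
      rcases hlev' with ⟨-, h1⟩ | ⟨-, h1⟩ <;> rw [h1] <;> constructor <;> linarith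
    exact ⟨(hstrict' v h h').1.le, (hstrict' v h h').2.le⟩
  -- the middle time and the middle dart
  obtain ⟨u, hcu, hud, hfu⟩ := exists_time_at_level (Λ := Λ) (lev := (q₁ + q₂) / 2) hcd hlev'
    (by linarith) (by linarith)
  set m := uIdx[Q, u] with hmdef
  have hcm : uIdx[Q, c] < m := by
    refine lt_of_le_of_ne (uIdx_mono Q hcu.le) (uIdx_ne_of_dist hp hδ.le (x := x) ?_)
    rw [hfu]
    rcases hlev' with ⟨h1, -⟩ | ⟨h1, -⟩ <;> rw [h1]
    · rw [abs_of_neg (by linarith)]; linarith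
    · rw [abs_of_pos (by linarith)]; linarith
  have hmd : m < uIdx[Q, d] := by
    refine lt_of_le_of_ne (uIdx_mono Q hud.le) (uIdx_ne_of_dist hp hδ.le (x := x) ?_)
    rw [hfu]
    rcases hlev' with ⟨-, h1⟩ | ⟨-, h1⟩ <;> rw [h1]
    · rw [abs_of_neg (by linarith)]; linarith
    · rw [abs_of_pos (by linarith)]; linarith
  have hmQ : m < Q := hmd.trans_le (uIdx_le Q d)
  -- the primal vertex of the middle dart and the touch point
  have hLP : dist (Λ u) (meshPoint δ (OrbitPolygon.cv β p m)) ≤ 3 * δ := dist_roundedCurve_meshPoint_le hp hδ.le u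
  have hballU : closedBall (meshPoint δ (OrbitPolygon.cv β p m)) δ ⊆ U := by
    intro w hw
    rw [mem_closedBall] at hw
    constructor
    · linarith [dist_triangle (Λ u) (meshPoint δ (OrbitPolygon.cv β p m)) x,
        dist_triangle (meshPoint δ (OrbitPolygon.cv β p m)) w x, dist_comm w (meshPoint δ (OrbitPolygon.cv β p m))]
    · linarith [dist_triangle w (meshPoint δ (OrbitPolygon.cv β p m)) x,
        dist_triangle (meshPoint δ (OrbitPolygon.cv β p m)) (Λ u) x, dist_comm (Λ u) (meshPoint δ (OrbitPolygon.cv β p m))]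
  obtain ⟨z, hzm, hzd, hzcl⟩ := exists_touchPoint hp hδ m hballU
  have hzU : q₁ < dist z x ∧ dist z x < q₂ := by
    constructor
    · linarith [dist_triangle (Λ u) (meshPoint δ (OrbitPolygon.cv β p m)) x,
        dist_triangle (meshPoint δ (OrbitPolygon.cv β p m)) z x, dist_comm z (meshPoint δ (OrbitPolygon.cv β p m))]
    · linarith [dist_triangle z (meshPoint δ (OrbitPolygon.cv β p m)) x,
        dist_triangle (meshPoint δ (OrbitPolygon.cv β p m)) (Λ u) x, dist_comm (Λ u) (meshPoint δ (OrbitPolygon.cv β p m))]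
  -- the touch point is on the inner crossing
  obtain ⟨uz, huz1, huz2, -, -, hΛuz⟩ := exists_time_of_mem_dartPiece hp hmQ hzm
  have hQ' : (0 : ℝ) < Q := by exact_mod_cast hQ
  have hcuz : c ≤ uz := by
    have h1 : (c : ℝ) < m / Q := lt_div_of_uIdx_lt hQ hcm
    exact (h1.trans_le huz1).le
  have huzd : uz ≤ d := by
    have h1 : ((m : ℝ) + 1) / Q ≤ d := div_le_of_lt_uIdx hQ hmd
    have h2 : ((m : ℝ) + 1 / 2) / Q ≤ ((m : ℝ) + 1) / Q := by gcongr; norm_num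
    exact (huz2.trans h2).trans h1
  have hzarc : z ∈ Λ '' {v | a ≤ v ∧ v ≤ b} := ⟨uz, ⟨hac.trans hcuz, huzd.trans hdb⟩, hΛuz⟩
  -- the chain of primal vertices of the darts `uIdx c, …, uIdx d`
  have hnear : ∀ v : I, |dist (meshPoint δ (OrbitPolygon.cv β p (uIdx[Q, v]))) x - dist (Λ v) x| ≤ 3 * δ :=
    fun v ↦ (abs_dist_sub_le _ _ _).trans (by rw [dist_comm]; exact dist_roundedCurve_meshPoint_le hp hδ.le v)
  have hrad : ∀ k, uIdx[Q, c] ≤ k → k ≤ uIdx[Q, d] →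
      q₁ + 5 * δ ≤ dist (meshPoint δ (OrbitPolygon.cv β p k)) x ∧
        dist (meshPoint δ (OrbitPolygon.cv β p k)) x ≤ q₂ - 5 * δ := by
    intro k hk1 hk2
    obtain ⟨v, hcv, hvd, hv⟩ := exists_time_of_uIdx hQ hcd.le hk1 hk2
    have h1 := hnear v
    rw [hv, abs_le] at h1
    obtain ⟨h2, h3⟩ := hmid' v hcv hvd
    constructor <;> linarith [h1.1, h1.2]
  have hballs : ∀ k, uIdx[Q, c] ≤ k → k ≤ uIdx[Q, d] → closedBall (meshPoint δ (OrbitPolygon.cv β p k)) δ ⊆ U := by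
    intro k hk1 hk2 w hw
    obtain ⟨h1, h2⟩ := hrad k hk1 hk2
    rw [mem_closedBall] at hw
    constructor
    · linarith [dist_triangle (meshPoint δ (OrbitPolygon.cv β p k)) w x, dist_comm w (meshPoint δ (OrbitPolygon.cv β p k))]
    · linarith [dist_triangle w (meshPoint δ (OrbitPolygon.cv β p k)) x]
  have hcomp : ∀ k, uIdx[Q, c] ≤ k → k ≤ uIdx[Q, d] → meshPoint δ (OrbitPolygon.cv β p k) ∈
      connectedComponentIn (U \ range (OrbitPolygon.loop β p δ)) (meshPoint δ (OrbitPolygon.cv β p m)) :=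
    fun k hk1 hk2 ↦ meshPoint_cv_mem_connectedComponentIn hp hδ hballs hk1 hk2 hcm.le hmd.le
  -- the ends of the chain
  have hends : (dist (meshPoint δ (OrbitPolygon.cv β p (uIdx[Q, c]))) x ≤ q₁ + 11 * δ ∧
        q₂ - 11 * δ ≤ dist (meshPoint δ (OrbitPolygon.cv β p (uIdx[Q, d]))) x) ∨
      (q₂ - 11 * δ ≤ dist (meshPoint δ (OrbitPolygon.cv β p (uIdx[Q, c]))) x ∧
        dist (meshPoint δ (OrbitPolygon.cv β p (uIdx[Q, d]))) x ≤ q₁ + 11 * δ) := by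
    have h1 := hnear c
    have h2 := hnear d
    rw [abs_le] at h1 h2
    rcases hlev' with ⟨hc, hd⟩ | ⟨hc, hd⟩
    · left
      rw [hc] at h1; rw [hd] at h2
      constructor <;> linarith [h1.1, h1.2, h2.1, h2.2]
    · right
      rw [hc] at h1; rw [hd] at h2
      constructor <;> linarith [h1.1, h1.2, h2.1, h2.2]
  -- assemble, by cases on the direction of the outer crossing
  have key : ∀ dir : Bool, (dist (Λ a) x = if dir then q₁ else q₂) → (dist (Λ b) x = if dir then q₂ else q₁) →
      ∃ (a b : I) (dir : Bool) (m k₀ k₁ : ℕ) (z : ℂ),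
      s ≤ a ∧ a < b ∧ b ≤ t ∧
      (dist (Λ a) x = if dir then q₁ else q₂) ∧ (dist (Λ b) x = if dir then q₂ else q₁) ∧
      (∀ v, a < v → v < b → q₁ < dist (Λ v) x ∧ dist (Λ v) x < q₂) ∧
      z ∈ Λ '' {v | a ≤ v ∧ v ≤ b} ∧ (q₁ < dist z x ∧ dist z x < q₂) ∧
      z ∈ closure (connectedComponentIn (U \ range (OrbitPolygon.loop β p δ))
        (meshPoint δ (OrbitPolygon.cv β p m))) ∧
      k₀ ≤ k₁ ∧
      (∀ k, k₀ ≤ k → k ≤ k₁ → meshPoint δ (OrbitPolygon.cv β p k) ∈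
        connectedComponentIn (U \ range (OrbitPolygon.loop β p δ)) (meshPoint δ (OrbitPolygon.cv β p m))) ∧
      ((dist (meshPoint δ (OrbitPolygon.cv β p k₀)) x ≤ q₁ + 11 * δ ∧
          q₂ - 11 * δ ≤ dist (meshPoint δ (OrbitPolygon.cv β p k₁)) x) ∨
        (q₂ - 11 * δ ≤ dist (meshPoint δ (OrbitPolygon.cv β p k₀)) x ∧
          dist (meshPoint δ (OrbitPolygon.cv β p k₁)) x ≤ q₁ + 11 * δ)) := by
    intro dir ha hb
    exact ⟨a, b, dir, m, uIdx[Q, c], uIdx[Q, d], z, hsa, hab, hbt, ha, hb, hstrict, hzarc, hzU, hzcl,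
      uIdx_mono Q hcd.le, hcomp, hends⟩
  rcases hlev with ⟨ha, hb⟩ | ⟨ha, hb⟩
  · exact key true (by simp [ha]) (by simp [hb])
  · exact key false (by simp [ha]) (by simp [hb])

end BondLoopH1

/-- **Registered anchor** (`bondLoopH1_exists_sector_chain`): a traversal of `D(x; ρ, R)` by the rounded
loop of the orbit of a periodic corner carries, for `ρ ≤ q₁`, `q₁ + 40δ ≤ q₂ ≤ R`, a strict crossing of the
closed shell `[q₁, q₂]`, a point of it in the closure of a complementary component of the open shell, and a
chain of primal vertices of the orbit in that component across `A(x; q₁ + 11δ, q₂ - 11δ)`.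
[cite: AizenmanBurchardDuke1999, Appendix A] -/
theorem bondLoopH1_exists_sector_chain : ∀ (β : BondConfig (Site 2)) (p : Site 2 × Fin 4),
    p ∈ periodicPts (nextCorner β) → ∀ (δ : ℝ), 0 < δ → ∀ (x : ℂ) (ρ R q₁ q₂ : ℝ), ρ ≤ q₁ →
    q₁ + 40 * δ ≤ q₂ → q₂ ≤ R → ∀ (s t : unitInterval),
    (Curve.ofPeriodic (OrbitPolygon.loop β p δ) OrbitPolygon.continuous_loop).IsTraversal x ρ R s t →
    ∃ (a b : unitInterval) (m k₀ k₁ : ℕ) (z : ℂ), s ≤ a ∧ a < b ∧ b ≤ t ∧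
      ((dist (OrbitPolygon.loop β p δ a) x = q₁ ∧ dist (OrbitPolygon.loop β p δ b) x = q₂) ∨
        (dist (OrbitPolygon.loop β p δ a) x = q₂ ∧ dist (OrbitPolygon.loop β p δ b) x = q₁)) ∧
      (∀ v : unitInterval, a < v → v < b →
        q₁ < dist (OrbitPolygon.loop β p δ v) x ∧ dist (OrbitPolygon.loop β p δ v) x < q₂) ∧
      (∃ v : unitInterval, a ≤ v ∧ v ≤ b ∧ OrbitPolygon.loop β p δ v = z) ∧
      (q₁ < dist z x ∧ dist z x < q₂) ∧
      z ∈ closure (connectedComponentIn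
        ({z | q₁ < dist z x ∧ dist z x < q₂} \ range (OrbitPolygon.loop β p δ))
        (meshPoint δ (OrbitPolygon.cv β p m))) ∧
      k₀ ≤ k₁ ∧
      (∀ k, k₀ ≤ k → k ≤ k₁ → meshPoint δ (OrbitPolygon.cv β p k) ∈ connectedComponentIn
        ({z | q₁ < dist z x ∧ dist z x < q₂} \ range (OrbitPolygon.loop β p δ))
        (meshPoint δ (OrbitPolygon.cv β p m))) ∧
      ((dist (meshPoint δ (OrbitPolygon.cv β p k₀)) x ≤ q₁ + 11 * δ ∧
          q₂ - 11 * δ ≤ dist (meshPoint δ (OrbitPolygon.cv β p k₁)) x) ∨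
        (q₂ - 11 * δ ≤ dist (meshPoint δ (OrbitPolygon.cv β p k₀)) x ∧
          dist (meshPoint δ (OrbitPolygon.cv β p k₁)) x ≤ q₁ + 11 * δ)) := by
  intro β p hp δ hδ x ρ R q₁ q₂ hρq hgap hqR s t htr
  obtain ⟨a, b, dir, m, k₀, k₁, z, hsa, hab, hbt, ha, hb, hstrict, ⟨v, ⟨hav, hvb⟩, hvz⟩, hzU, hzcl,
    hk, hcomp, hends⟩ := BondLoopH1.exists_traversal_data hp hδ hρq hgap hqR htr
  refine ⟨a, b, m, k₀, k₁, z, hsa, hab, hbt, ?_, hstrict, ⟨v, hav, hvb, hvz⟩, hzU, hzcl, hk, hcomp, hends⟩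
  cases dir
  · right; exact ⟨by simpa using ha, by simpa using hb⟩
  · left; exact ⟨by simpa using ha, by simpa using hb⟩

end Summit.CriticalPhenomena.CardyFormulaZ2.Cruxes.NestingRigidity.PositiveConeWeightDoubling

end
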